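import Mathlib

/-!
# `SnSubsetDichotomy.HyperoctahedralSubsets`, line `spherical-rank-sieve` — SUB-HOST TRANSPORT

Helper for crux `stmt-MatrixMultiplication-8305` (lead c1; memo `Cruxes/HyperoctahedralSubsets/LeadC1-PoorCore.md`
§5).  The bulk form of the matching lemma is attacked by recursion over pieces: a vertex set `S ⊆ Fin n`
that is invariant under the three matchings `μ 0, μ 1, μ 2` (a union of components, or a re-matched piece
after surgery — see `stub_surgeryTransfer`) is itself a host on `|S|` points, and local triples found
there must be transported back to `Fin n`.  This file provides that transport:

* the SUB-HOST on `Fin s` along an enumeration `e : Fin s ≃ {v // v ∈ S}` is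
  `ν c := e.symm.permCongr ((μ c).subtypePerm _)` (restrict `μ c` to `S`, conjugate to `Fin s`);
  `subhost_mul_self` / `subhost_ne` record that the `ν c` are again fixed-point-free involutions when the
  `μ c` are;
* `comm_extendDomain_of_comm` — a permutation of `Fin s` commuting with `ν c` extends by the identity
  (`Equiv.Perm.extendDomain`) to a permutation of `Fin n` commuting with `μ c`;
* `stub_subhostTransport` — hence a family of support-disjoint commuting local triples for `ν` yields one
  for `μ`, supported inside `S`, in the input format of the landed bridge `stub_triplesToGroup` (p79923).

[folklore]
-/

-- the project's summit namespace `Summit.MatrixMultiplication.MatrixMultiplication` repeats a component by design (D-0022)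
set_option linter.dupNamespace false

namespace Summit.MatrixMultiplication.MatrixMultiplication.Theorems.HyperoctahedralSubsets

open Equiv Equiv.Perm

namespace SubhostTransport

variable {α β : Type*} {p : β → Prop}

/-- The restricted-and-conjugated permutation, evaluated: `e (ν x) = ⟨σ (e x), _⟩`. [folklore] -/
theorem apply_subhost (σ : Perm β) (hσ : ∀ x, p (σ x) ↔ p x) (e : α ≃ Subtype p) (x : α) :
    ((e (e.symm.permCongr (σ.subtypePerm hσ) x) : Subtype p) : β) = σ (e x) := by
  simp [Equiv.permCongr_apply, subtypePerm_apply]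

/-- **Commutation extends.**  If `a'` commutes with the sub-host permutation
`ν = e.symm.permCongr (σ.subtypePerm hσ)` then `a'.extendDomain e` commutes with `σ`. [folklore] -/
theorem comm_extendDomain_of_comm [DecidablePred p] (σ : Perm β) (hσ : ∀ x, p (σ x) ↔ p x)
    (e : α ≃ Subtype p) (a' : Perm α)
    (h : a' * e.symm.permCongr (σ.subtypePerm hσ) = e.symm.permCongr (σ.subtypePerm hσ) * a') :
    a'.extendDomain e * σ = σ * a'.extendDomain e := by
  set ν : Perm α := e.symm.permCongr (σ.subtypePerm hσ) with hν
  have hcomm : ∀ x, a' (ν x) = ν (a' x) := fun x => by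
    have := congrArg (fun τ : Perm α => τ x) h
    simpa using this
  have hνval : ∀ x, ((e (ν x) : Subtype p) : β) = σ (e x) := fun x => apply_subhost σ hσ e x
  ext v
  simp only [Perm.coe_mul, Function.comp_apply]
  by_cases hv : p v
  · -- `v = e x`
    obtain ⟨x, hx⟩ : ∃ x, (e x : β) = v := ⟨e.symm ⟨v, hv⟩, by simp⟩
    subst hx
    rw [Perm.extendDomain_apply_image, ← hνval, Perm.extendDomain_apply_image, hcomm, hνval]
  · have hv' : ¬ p (σ v) := fun h' => hv ((hσ v).1 h')
    rw [Perm.extendDomain_apply_not_subtype _ _ hv, Perm.extendDomain_apply_not_subtype _ _ hv']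

/-- The sub-host permutations are involutions if the originals are. [folklore] -/
theorem subhost_mul_self (σ : Perm β) (hσ : ∀ x, p (σ x) ↔ p x) (e : α ≃ Subtype p)
    (h : σ * σ = 1) :
    e.symm.permCongr (σ.subtypePerm hσ) * e.symm.permCongr (σ.subtypePerm hσ) = 1 := by
  rw [← Equiv.permCongr_mul]
  have : σ.subtypePerm hσ * σ.subtypePerm hσ = 1 := by
    ext x
    simp [h]
  rw [this]
  ext x
  simp

/-- The sub-host permutations are fixed-point-free if the originals are. [folklore] -/
theorem subhost_ne (σ : Perm β) (hσ : ∀ x, p (σ x) ↔ p x) (e : α ≃ Subtype p)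
    (h : ∀ v, σ v ≠ v) (x : α) : e.symm.permCongr (σ.subtypePerm hσ) x ≠ x := by
  intro hx
  have := congrArg (fun y => ((e y : Subtype p) : β)) hx
  simp only [apply_subhost] at this
  exact h _ this

end SubhostTransport

open SubhostTransport in
/-- **Sub-host transport of local triples** (crux `SnSubsetDichotomy.HyperoctahedralSubsets`,
stmt-MatrixMultiplication-8305, line `spherical-rank-sieve`).  Let `S ⊆ Fin n` be invariant under the
permutations `μ 0, μ 1, μ 2`, enumerated by `e : Fin s ≃ {v // v ∈ S}`, and let
`ν c := e.symm.permCongr ((μ c).subtypePerm _)` be the sub-host on `Fin s`.  Every family of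
support-disjoint commuting local triples `(a' j, b' j)` for `ν` (commuting involutions, not both
trivial, `a' j ∈ C(ν 0)`, `b' j ∈ C(ν 1)`, `a' j · b' j ∈ C(ν 2)`) extends by the identity off `S` to a
family of support-disjoint commuting local triples for `μ`, each supported inside `S` — the input
format of the landed bridge `stub_triplesToGroup`.  Proof: `Equiv.Perm.extendDomain` is an injective
group homomorphism, and commutation extends (`comm_extendDomain_of_comm`). [folklore] -/
theorem stub_subhostTransport :
    ∀ (n s : ℕ) (μ : Fin 3 → Equiv.Perm (Fin n)) (S : Finset (Fin n))
      (hS : ∀ c, ∀ v, μ c v ∈ S ↔ v ∈ S) (e : Fin s ≃ {v // v ∈ S}) (g : ℕ)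
      (a' b' : Fin g → Equiv.Perm (Fin s)),
      (∀ j, a' j * a' j = 1 ∧ b' j * b' j = 1 ∧ a' j * b' j = b' j * a' j ∧ (a' j ≠ 1 ∨ b' j ≠ 1) ∧
        a' j * e.symm.permCongr ((μ 0).subtypePerm (hS 0)) =
          e.symm.permCongr ((μ 0).subtypePerm (hS 0)) * a' j ∧
        b' j * e.symm.permCongr ((μ 1).subtypePerm (hS 1)) =
          e.symm.permCongr ((μ 1).subtypePerm (hS 1)) * b' j ∧
        a' j * b' j * e.symm.permCongr ((μ 2).subtypePerm (hS 2)) =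
          e.symm.permCongr ((μ 2).subtypePerm (hS 2)) * (a' j * b' j)) →
      (∀ j j' : Fin g, j ≠ j' → ∀ x, (a' j x ≠ x ∨ b' j x ≠ x) → a' j' x = x ∧ b' j' x = x) →
      ∃ (a b : Fin g → Equiv.Perm (Fin n)),
        (∀ j, a j * a j = 1 ∧ b j * b j = 1 ∧ a j * b j = b j * a j ∧ (a j ≠ 1 ∨ b j ≠ 1) ∧
          a j * μ 0 = μ 0 * a j ∧ b j * μ 1 = μ 1 * b j ∧ a j * b j * μ 2 = μ 2 * (a j * b j)) ∧
        (∀ j j' : Fin g, j ≠ j' → ∀ v, (a j v ≠ v ∨ b j v ≠ v) → a j' v = v ∧ b j' v = v) ∧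
        (∀ j v, (a j v ≠ v ∨ b j v ≠ v) → v ∈ S) := by
  intro n s μ S hS e g a' b' htrip hdisj
  refine ⟨fun j => (a' j).extendDomain e, fun j => (b' j).extendDomain e, ?_, ?_, ?_⟩
  · intro j
    obtain ⟨haa, hbb, hab, hne, ha0, hb1, hab2⟩ := htrip j
    refine ⟨?_, ?_, ?_, ?_, ?_, ?_, ?_⟩
    · rw [Perm.extendDomain_mul, haa, Perm.extendDomain_one]
    · rw [Perm.extendDomain_mul, hbb, Perm.extendDomain_one]
    · rw [Perm.extendDomain_mul, Perm.extendDomain_mul, hab]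
    · rcases hne with h | h
      · exact Or.inl fun h1 => h (Perm.extendDomain_eq_one_iff.1 h1)
      · exact Or.inr fun h1 => h (Perm.extendDomain_eq_one_iff.1 h1)
    · exact comm_extendDomain_of_comm (μ 0) (hS 0) e (a' j) ha0
    · exact comm_extendDomain_of_comm (μ 1) (hS 1) e (b' j) hb1
    · rw [Perm.extendDomain_mul]
      exact comm_extendDomain_of_comm (μ 2) (hS 2) e (a' j * b' j) hab2
  · intro j j' hjj' v hv
    by_cases hvS : v ∈ S
    · obtain ⟨x, hx⟩ : ∃ x, ((e x : {v // v ∈ S}) : Fin n) = v := ⟨e.symm ⟨v, hvS⟩, by simp⟩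
      subst hx
      simp only [Perm.extendDomain_apply_image] at hv ⊢
      have hv' : a' j x ≠ x ∨ b' j x ≠ x := by
        rcases hv with hv | hv
        · exact Or.inl fun h => hv (by rw [h])
        · exact Or.inr fun h => hv (by rw [h])
      obtain ⟨h1, h2⟩ := hdisj j j' hjj' x hv'
      exact ⟨by rw [h1], by rw [h2]⟩
    · exfalso
      rcases hv with hv | hv
      · exact hv (Perm.extendDomain_apply_not_subtype _ _ hvS)
      · exact hv (Perm.extendDomain_apply_not_subtype _ _ hvS)
  · intro j v hv
    by_contra hvS
    rcases hv with hv | hv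
    · exact hv (Perm.extendDomain_apply_not_subtype _ _ hvS)
    · exact hv (Perm.extendDomain_apply_not_subtype _ _ hvS)

end Summit.MatrixMultiplication.MatrixMultiplication.Theorems.HyperoctahedralSubsets
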